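import Mathlib
import Summits.NavierStokesRegularity.NavierStokesRegularity.Theorems.TaoLadderRungTwoFlatCaptureDevProfile
import HarnessLib

/-!
# THE ENTRY HOP WITH A PER-SHELL, WEIGHTED NEAR BUDGET (theory-1 §69 A69-2) on top of the deviation profile / per-hop window of `…CaptureDevProfile`
  (helper for the K_A♭ parent item stmt-NavierStokesRegularity-22987 `FlatGapCertificatesV2`, child 2A `GradedAdiabaticWakeA` of route
  TaoLadderRungTwoFlat; cell harvest/h2-tao-ladder, p1 g25; LADDER §49, §50, §52, §69)

`entryLanding_of_dev` books the near clause at entry through ONE unweighted deviation level `ρ` on the block `[−D, −K−1]`, `card·ρ² ≤ f²·v(N₀+1)`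
— as theory-1 measured (CAPTURE-69 §69.3), that forces the launch junk packet below shell `−D` before entry (`N₀ = 18` instead of `7`). The co-moving
weights `e^{θ_V(k+K)} ≤ 1` decay into the block, and the deviation of the landed state is naturally PER SHELL (`D_{1+k}` profile + reference near
residual `ρ_N(k)` + scale mismatch `(D_1/A_*)·M_u(k)`). This module re-types the near piece accordingly and re-assembles the entry landing.

* `near_landing_of_profile` — `NearClause` at `n+1` from per-shell deviations `E_k` and the weighted row `Σ_k e^{θ_V(k+K)}E_k² ≤ a²v(n+1)`;
* `entryLanding_of_devW` — the five clauses at one good time from a deviation PROFILE `D_k ≤ D`, per-shell near rows, weighted near budget;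
* `tubeStepLandWith_entry_of_devProfileW` — `TubeStepLandWith` of the split tube at `n = N₀` from the profile on a per-hop window, weighted near.

HONEST FRAMING: composition over the cell's typed induction frame (MODEL lattice, graded mirror table on `S♭`); the deviation profile, reference rows
and budgets are HYPOTHESES; nothing certified; no item closed; nothing about the Navier–Stokes equations.
-/

noncomputable section

-- the sub-problem namespace repeats the summit name by design (D-0017)
set_option linter.dupNamespace false

namespace Summit.NavierStokesRegularity.NavierStokesRegularity.Theorems.HopTube

open Set Finset Literature.Analysis.FluidPDE Literature.Analysis.FluidPDE.TaoCascade MirrorPulse RenormFrame QuadPolar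
  GappedFrontRobustOn

section EntryW

variable {ε ε₀ : ℝ}

/-- **NEAR landing from a per-shell deviation profile and a WEIGHTED row** (A69-2): if on the block `[−D, −K−1]`
`|S_{i,1+k}(τ₁) − (|S_{i₀,1}(τ₁)|/A_*)·u⋆_{ik}| ≤ E_k` and `Σ_k e^{θ_V(k+K)}·E_k² ≤ a²·v(n+1)`, then `NearClause` holds at `n+1` for the
re-centred state. [cite: Tao2016AveragedNS, §6.3–6.4 (statement shape); cell LADDER §49, §50.8, §52; theory-1 §69 A69-2] -/
theorem near_landing_of_profile (P : TubeSchedule) {i₀ : Fin 2} {ustar : Fin 2 → ℤ → ℝ} {S : Fin 2 → ℤ → ℝ → ℝ} {τ₁ a : ℝ} {n : ℕ}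
    (ha : 0 < a) (hθ : 0 ≤ P.θV) {E : ℤ → ℝ}
    (hdev : ∀ (i : Fin 2) (k : ℤ), -(P.D : ℤ) ≤ k → k ≤ -(P.K : ℤ) - 1 →
      |S i (1 + k) τ₁ - |S i₀ 1 τ₁| / P.Astar * ustar i k| ≤ E k)
    (hrow : ∑ k ∈ Finset.Icc (-(P.D : ℤ)) (-(P.K : ℤ) - 1), Real.exp (P.θV * ((k : ℝ) + P.K)) * E k ^ 2 ≤ a ^ 2 * P.v (n + 1)) :
    NearClause P i₀ ustar (n + 1) (recentre S τ₁ a) := by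
  have _ := hθ
  refine nearClause_recentre P ha (le_trans (Finset.sum_le_sum fun k hk => ?_) hrow)
  rw [Finset.mem_Icc] at hk
  have hsq : ∀ i : Fin 2, (S i (1 + k) τ₁ - |S i₀ 1 τ₁| / P.Astar * ustar i k) ^ 2 ≤ E k ^ 2 := by
    intro i
    have h := hdev i k hk.1 hk.2
    have he0 : 0 ≤ E k := (abs_nonneg _).trans h
    exact sq_le_sq' (by linarith [(abs_le.mp h).1]) (abs_le.mp h).2
  have hsum : ∑ i : Fin 2, (S i (1 + k) τ₁ - |S i₀ 1 τ₁| / P.Astar * ustar i k) ^ 2 / 2 ≤ E k ^ 2 := by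
    rw [Fin.sum_univ_two]
    have h0 := hsq 0; have h1 := hsq 1
    linarith
  exact mul_le_mul_of_nonneg_left hsum (Real.exp_pos _).le

/-- **THE FIVE CLAUSES AT ONE GOOD TIME OF THE ENTRY HOP, from a deviation PROFILE and PER-SHELL near rows** (theory-1 §69 A69-2: the near entry
budget weighted shell by shell, `Σ_k e^{θ_V(k+K)}·(D_{1+k} + ρ_N(k) + (D_1/A_*)·M_u(k))² ≤ f²·v(N₀+1)`, instead of `card·ρ²`).
[cite: Tao2016AveragedNS, §6.3–6.4 Props. 6.4–6.5 (statement shape of the checkpoint step); route TaoLadderRungTwoFlat, entry hop (cell LADDER §50, §52, §54, §64.2)] -/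
theorem entryLanding_of_devW (P : TubeSchedule) {δs : ℕ → ℝ} {θ' : ℝ} {Wb : ℕ → ℝ} {i₀ : Fin 2} {w : ℤ → ℝ} {r θ₀ t : ℝ}
    {ustar : Fin 2 → ℤ → ℝ} {S Z : Fin 2 → ℤ → ℝ → ℝ} {D MZ : ℝ} {Dk : ℤ → ℝ}
    (hε₀ : 0 < ε₀) (hAstar : 0 < P.Astar) (hg : 1 ≤ P.g) (hb : 1 ≤ P.b) (hθV : 0 ≤ P.θV) (hw0 : ∀ k, 0 < w k) (hr0 : 0 ≤ r)
    (hγ : 0 ≤ P.γ (P.N₀ + 1)) (hδ : 0 ≤ P.δ (P.N₀ + 1)) (hδs : 0 ≤ δs (P.N₀ + 1)) (hv : 0 ≤ P.v (P.N₀ + 1))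
    (hWb : 0 ≤ Wb (P.N₀ + 1))
    -- the deviation at time `t`, the reference bound, the behind cap and the landed ahead clause
    (hdk : ∀ (i : Fin 2) (k : ℤ), |S i k t - Z i k t| ≤ Dk k) (hDk : ∀ k, Dk k ≤ D) (hZt : ∀ (i : Fin 2) (k : ℤ), |Z i k t| ≤ MZ)
    (hcap : ∃ Λ : ℝ, 0 ≤ Λ ∧ R54.BehindCapClause P.K Λ (recentre S t (clampedRatio P i₀ ε₀ θ₀ t S)))
    (hAh : AheadClause P w r (recentre S t (clampedRatio P i₀ ε₀ θ₀ t S)))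
    -- rows along the reference at time `t`
    {δ₁ Mω δ₂ δ₃' : ℝ} {ρN Mu : ℤ → ℝ}
    (hrefC : P.Astar * (1 - P.γ (P.N₀ + 1)) * (1 + ε₀) ^ (-θ₀) + D ≤ |Z i₀ 1 t|)
    (hrefW : ∀ (i : Fin 2) (k : ℤ), -(P.K : ℤ) ≤ k → k < (P.k₁ : ℤ) →
      MirrorPulse.geomGauge P.g P.b i k * |Z i (1 + k) t - |Z i₀ 1 t| / P.Astar * ustar i k| ≤ δ₁)
    (hMω : ∀ (i : Fin 2) (k : ℤ), -(P.K : ℤ) ≤ k → k < (P.k₁ : ℤ) → MirrorPulse.geomGauge P.g P.b i k * |ustar i k| ≤ Mω)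
    (hdom : ∀ (i : Fin 2) (k : ℤ), (P.k₁ : ℤ) ≤ k →
      MirrorPulse.geomGauge P.g P.b i k * (max ((1 + ε₀) ^ (-θ₀)) ((MZ + D) / P.Astar) * r) ≤ 8 * δ₂ * w k)
    (hutail : ∀ (i : Fin 2) (k : ℤ), (P.k₁ : ℤ) ≤ k → MirrorPulse.geomGauge P.g P.b i k * |ustar i k| ≤ δ₃')
    (hrefN : ∀ (i : Fin 2) (k : ℤ), -(P.D : ℤ) ≤ k → k ≤ -(P.K : ℤ) - 1 →
      |Z i (1 + k) t - |Z i₀ 1 t| / P.Astar * ustar i k| ≤ ρN k)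
    (hMu : ∀ (i : Fin 2) (k : ℤ), -(P.D : ℤ) ≤ k → k ≤ -(P.K : ℤ) - 1 → |ustar i k| ≤ Mu k)
    (hrefB : ∀ L : ℕ, R54.behindEnergy P.K L θ' (fun i k => |Z i (1 + k) t| + D) ≤ ((1 + ε₀) ^ (-θ₀)) ^ 2 * Wb (P.N₀ + 1))
    -- budgets
    (hbudC : max (P.g ^ P.k₁ * D + δ₁ + D / P.Astar * Mω) (δ₂ + (MZ + D) / P.Astar * δ₃')
      ≤ (1 + ε₀) ^ (-θ₀) * P.δ (P.N₀ + 1))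
    (hbudS : max (P.g ^ P.k₁ * D + δ₁ + D / P.Astar * Mω) (δ₂ + (MZ + D) / P.Astar * δ₃')
      ≤ (1 + ε₀) ^ (-θ₀) * δs (P.N₀ + 1))
    (hbudN : ∑ k ∈ Finset.Icc (-(P.D : ℤ)) (-(P.K : ℤ) - 1),
        Real.exp (P.θV * ((k : ℝ) + P.K)) * (Dk (1 + k) + ρN k + Dk 1 / P.Astar * Mu k) ^ 2
      ≤ ((1 + ε₀) ^ (-θ₀)) ^ 2 * P.v (P.N₀ + 1)) :
    AnchorClause P i₀ (P.N₀ + 1) (recentre S t (clampedRatio P i₀ ε₀ θ₀ t S)) ∧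
      CoreClause P i₀ ustar (P.N₀ + 1) (recentre S t (clampedRatio P i₀ ε₀ θ₀ t S)) ∧
      NearClause P i₀ ustar (P.N₀ + 1) (recentre S t (clampedRatio P i₀ ε₀ θ₀ t S)) ∧
      splitBcl P (behindR54 P θ' Wb) δs i₀ ustar (P.N₀ + 1) (recentre S t (clampedRatio P i₀ ε₀ θ₀ t S)) ∧
      AheadClause P w r (recentre S t (clampedRatio P i₀ ε₀ θ₀ t S)) := by
  have hε' : (-1 : ℝ) < ε₀ := by linarith
  have hd : ∀ (i : Fin 2) (k : ℤ), |S i k t - Z i k t| ≤ D := fun i k => (hdk i k).trans (hDk k)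
  set a := clampedRatio P i₀ ε₀ θ₀ t S with ha_def
  set f := (1 + ε₀) ^ (-θ₀) with hf_def
  have hf : 0 < f := Real.rpow_pos_of_pos (by linarith) _
  have hfa : f ≤ a := floor_le_clampedRatio P i₀ ε₀ θ₀ t S
  have ha : 0 < a := hf.trans_le hfa
  have hg0 : 0 < P.g := lt_of_lt_of_le one_pos hg
  have hb0 : 0 < P.b := lt_of_lt_of_le one_pos hb
  have hω0 : ∀ i k, 0 ≤ MirrorPulse.geomGauge P.g P.b i k := fun i k => (MirrorPulse.geomGauge_pos hg0 hb0 i k).le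
  have hD0 : 0 ≤ D := (abs_nonneg _).trans (hd 0 0)
  have hMZ0 : 0 ≤ MZ := (abs_nonneg _).trans (hZt 0 0)
  -- the carrier and its scale
  have hcarU : |S i₀ 1 t| ≤ MZ + D := by
    have := abs_sub_abs_le_abs_sub (S i₀ 1 t) (Z i₀ 1 t); linarith [hd i₀ 1, hZt i₀ 1]
  have hcarL : P.Astar * (1 - P.γ (P.N₀ + 1)) * (1 + ε₀) ^ (-θ₀) ≤ |S i₀ 1 t| := by
    have := abs_sub_abs_le_abs_sub (Z i₀ 1 t) (S i₀ 1 t)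
    have h := hd i₀ 1; rw [abs_sub_comm] at h
    linarith
  have hx : abs (|S i₀ 1 t| / P.Astar - |Z i₀ 1 t| / P.Astar) ≤ D / P.Astar := by
    rw [← sub_div, abs_div, abs_of_pos hAstar]
    exact div_le_div_of_nonneg_right ((abs_abs_sub_abs_le_abs_sub _ _).trans (hd i₀ 1)) hAstar.le
  have hxU : |S i₀ 1 t| / P.Astar ≤ (MZ + D) / P.Astar := div_le_div_of_nonneg_right hcarU hAstar.le
  have hamax : a ≤ max f ((MZ + D) / P.Astar) := clampedRatio_le_of_carrier P i₀ ε₀ θ₀ t S hAstar hcarU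
  -- ANCHOR
  have hA : AnchorClause P i₀ (P.N₀ + 1) (recentre S t a) :=
    ⟨anchorLower_of_carrier P i₀ hε' θ₀ t S hAstar hγ hcarL, abs_recentre_anchor_le P i₀ hε' θ₀ t S hAstar⟩
  -- CORE: the gauge bound on `k ≥ −K` by (W)+(T1)+(T2)
  have hwin : ∀ (i : Fin 2) (k : ℤ), -(P.K : ℤ) ≤ k → k < (P.k₁ : ℤ) → |S i (1 + k) t - Z i (1 + k) t| ≤ D :=
    fun i k _ _ => hd i (1 + k)
  have hahead' : ∀ (i : Fin 2) (k : ℤ), (P.k₁ : ℤ) ≤ k → 8 * (w k * |S i (1 + k) t|) ≤ a * r := by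
    intro i k hk
    have h := hAh i k hk
    simp only [recentre, abs_div, abs_of_pos ha] at h
    rw [mul_div_assoc'] at h
    rwa [mul_div_assoc', div_le_iff₀ ha, mul_comm r a] at h
  have hdom' : ∀ (i : Fin 2) (k : ℤ), (P.k₁ : ℤ) ≤ k → MirrorPulse.geomGauge P.g P.b i k * (a * r) ≤ 8 * δ₂ * w k :=
    fun i k hk => (mul_le_mul_of_nonneg_left (mul_le_mul_of_nonneg_right hamax hr0) (hω0 i k)).trans (hdom i k hk)
  have hty := gauge_tail_of_ahead (y := fun i k => S i (1 + k) t) hω0 hw0 hahead' hdom'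
  have htu : ∀ (i : Fin 2) (k : ℤ), (P.k₁ : ℤ) ≤ k →
      MirrorPulse.geomGauge P.g P.b i k * (abs (|S i₀ 1 t| / P.Astar) * |ustar i k|) ≤ (MZ + D) / P.Astar * δ₃' := by
    intro i k hk
    rw [abs_of_nonneg (div_nonneg (abs_nonneg _) hAstar.le)]
    calc MirrorPulse.geomGauge P.g P.b i k * (|S i₀ 1 t| / P.Astar * |ustar i k|)
        = |S i₀ 1 t| / P.Astar * (MirrorPulse.geomGauge P.g P.b i k * |ustar i k|) := by ring
      _ ≤ (MZ + D) / P.Astar * δ₃' :=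
          mul_le_mul hxU (hutail i k hk) (mul_nonneg (hω0 i k) (abs_nonneg _)) (by positivity)
  have hGk : (P.k₁ : ℤ).toNat = P.k₁ := Int.toNat_natCast _
  have hcoreBound : ∀ B : ℝ, max (P.g ^ P.k₁ * D + δ₁ + D / P.Astar * Mω) (δ₂ + (MZ + D) / P.Astar * δ₃') ≤ f * B → 0 ≤ B →
      ∀ (i : Fin 2) (k : ℤ), -(P.K : ℤ) ≤ k →
        MirrorPulse.geomGauge P.g P.b i k * |S i (1 + k) t - |S i₀ 1 t| / P.Astar * ustar i k| ≤ a * B := by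
    intro B hB hB0 i k hk
    have hGle : ∀ (i : Fin 2) (k : ℤ), -(P.K : ℤ) ≤ k → k < (P.k₁ : ℤ) →
        MirrorPulse.geomGauge P.g P.b i k ≤ P.g ^ (P.k₁ : ℤ).toNat := fun i k _ hk => geomGauge_le_pow_of_lt hg hb i hk
    have hmain := gauge_dev_le_of_window_and_tail₂ (y := fun i k => S i (1 + k) t) (u := ustar)
      (x := |S i₀ 1 t| / P.Astar) hω0 hwin hrefW hGle hMω hx hty htu i k hk
    rw [hGk] at hmain
    exact hmain.trans (hB.trans (mul_le_mul_of_nonneg_right hfa hB0))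
  have hC : CoreClause P i₀ ustar (P.N₀ + 1) (recentre S t a) := coreClause_recentre P ha (hcoreBound _ hbudC hδ)
  have hCs : CoreClauseFrom P δs i₀ ustar (P.N₀ + 1) (recentre S t a) :=
    coreClauseFrom_recentre P ha fun i k hk => hcoreBound _ hbudS hδs i k (by omega)
  -- NEAR (per-shell, weighted)
  have hx1 : abs (|S i₀ 1 t| / P.Astar - |Z i₀ 1 t| / P.Astar) ≤ Dk 1 / P.Astar := by
    rw [← sub_div, abs_div, abs_of_pos hAstar]
    exact div_le_div_of_nonneg_right ((abs_abs_sub_abs_le_abs_sub _ _).trans (hdk i₀ 1)) hAstar.le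
  have hN : NearClause P i₀ ustar (P.N₀ + 1) (recentre S t a) := by
    refine near_landing_of_profile P ha hθV (E := fun k => Dk (1 + k) + ρN k + Dk 1 / P.Astar * Mu k) (fun i k hk1 hk2 => ?_)
      (hbudN.trans (mul_le_mul_of_nonneg_right (pow_le_pow_left₀ hf.le hfa 2) hv))
    have h1 := hdk i (1 + k)
    have h2 := hrefN i k hk1 hk2
    have h3 : |(|Z i₀ 1 t| / P.Astar - |S i₀ 1 t| / P.Astar) * ustar i k| ≤ Dk 1 / P.Astar * Mu k := by
      rw [abs_mul, abs_sub_comm]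
      exact mul_le_mul hx1 (hMu i k hk1 hk2) (abs_nonneg _) (div_nonneg ((abs_nonneg _).trans (hdk i₀ 1)) hAstar.le)
    have e : S i (1 + k) t - |S i₀ 1 t| / P.Astar * ustar i k = (S i (1 + k) t - Z i (1 + k) t)
        + (Z i (1 + k) t - |Z i₀ 1 t| / P.Astar * ustar i k) + (|Z i₀ 1 t| / P.Astar - |S i₀ 1 t| / P.Astar) * ustar i k := by
      ring
    rw [e]
    exact ((abs_add_le _ _).trans (add_le_add ((abs_add_le _ _).trans (add_le_add h1 h2)) h3))
  -- BEHIND (B1) from the majorant, (B2∃) given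
  have hB1 : R54.BehindEnergyClause P.K θ' (Wb (P.N₀ + 1)) (recentre S t a) := by
    intro L
    have hm : ∀ (i : Fin 2) (k : ℤ), |S i (1 + k) t| ≤ (fun (i : Fin 2) (k : ℤ) => |Z i (1 + k) t| + D) i k := by
      intro i k
      have := abs_sub_abs_le_abs_sub (S i (1 + k) t) (Z i (1 + k) t); simp only; linarith [hd i (1 + k)]
    refine (behindEnergy_recentre_le ha hm).trans ?_
    rw [div_le_iff₀ (by positivity)]
    exact ((hrefB L).trans (mul_le_mul_of_nonneg_right (pow_le_pow_left₀ hf.le hfa 2) hWb)).trans_eq (mul_comm _ _)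
  exact ⟨hA, hC, hN, ⟨⟨hB1, hcap⟩, hCs⟩, hAh⟩

/-- **`TubeStepLandWith` OF THE SPLIT R54 TUBE AT THE ENTRY HOP `n = N₀`, FROM A DEVIATION PROFILE ON A PER-HOP WINDOW, WEIGHTED NEAR** (A69-2) (`|S_{ik} − Z_{ik}| ≤ D_k ≤ D`,
good times in `[t_lo, t_hi]`, reference rows over `[t_lo, t_hi]`, ahead rows with the profile), the (B2∃) cap, the cut schedule, `entryLanding_of_dev`.
[cite: Tao2016AveragedNS, §6.3–6.4 Props. 6.4–6.5 (statement shape); route TaoLadderRungTwoFlat, entry hop (cell LADDER §50, §52, §54, §64.2)] -/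
theorem tubeStepLandWith_entry_of_devProfileW (P : TubeSchedule) {δs : ℕ → ℝ} {θ' : ℝ} {Wb : ℕ → ℝ} {i₀ : Fin 2}
    {X₀ : Fin 2 → ℝ} {w : ℤ → ℝ} {r θ₀ c₀ t₀ : ℝ} {ζ : ℕ → Fin 2 → ℤ → ℝ} {ustar : Fin 2 → ℤ → ℝ}
    {good : ℕ → (Fin 2 → ℤ → ℝ → ℝ) → ℝ → Prop}
    (hε : 0 ≤ ε) (hε₀ : 0 < ε₀) (hc₀ : 0 < c₀)
    (hζ0 : ζ 0 = datumState i₀ X₀) (hη0 : 0 ≤ P.η 0) (hk₁ : 1 ≤ P.k₁) (hr0 : 0 ≤ r)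
    (hw1 : ∀ k, 1 ≤ w k) (hAstar : 0 < P.Astar) (hg : 1 ≤ P.g) (hb : 1 ≤ P.b)
    (hθV : 0 ≤ P.θV) (hθ₀ : 0 ≤ θ₀) (hθ₀1 : θ₀ ≤ 1) (hAFL : 0 < 1 - θ₀ * ε₀)
    (hγ : 0 ≤ P.γ (P.N₀ + 1)) (hδ : 0 ≤ P.δ (P.N₀ + 1)) (hδs : 0 ≤ δs (P.N₀ + 1)) (hv : 0 ≤ P.v (P.N₀ + 1))
    (hWb : 0 ≤ Wb (P.N₀ + 1))
    -- the reference trajectory of the entry hop, its plain bound, and the DEVIATION of every premise from it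
    {Z : Fin 2 → ℤ → ℝ → ℝ} {MZ D : ℝ} (hZp : ∀ i k, ∀ t ∈ Icc 0 c₀, |Z i k t| ≤ MZ)
    {Dk : ℤ → ℝ} (hDk : ∀ k, Dk k ≤ D)
    (hdevk : ∀ z S₀ τ S F, HopPremiseWith P (splitBcl P (behindR54 P θ' Wb) δs i₀ ustar) shiftSetFlat ε₀ i₀ (mirrorTable ε ε) X₀ w
      r c₀ ζ ustar P.N₀ z S₀ τ S F → ∀ (i : Fin 2) (k : ℤ), ∀ s ∈ Icc 0 c₀, |S i k s - Z i k s| ≤ Dk k)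
    -- good section times
    {tlo thi : ℝ} (htlo : 0 < tlo)
    (hex : ∀ z S₀ τ S F, HopPremiseWith P (splitBcl P (behindR54 P θ' Wb) δs i₀ ustar) shiftSetFlat ε₀ i₀ (mirrorTable ε ε) X₀ w
      r c₀ ζ ustar P.N₀ z S₀ τ S F → ∃ t, good P.N₀ S t)
    (hwin : ∀ z S₀ τ S F, HopPremiseWith P (splitBcl P (behindR54 P θ' Wb) δs i₀ ustar) shiftSetFlat ε₀ i₀ (mirrorTable ε ε) X₀ w
      r c₀ ζ ustar P.N₀ z S₀ τ S F → ∀ t, good P.N₀ S t → tlo ≤ t ∧ t ≤ thi) (hthi : thi ≤ c₀)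
    -- rows along the reference on the clock window; t-independent rows; budgets
    {δ₁ Mω δ₂ δ₃' : ℝ} {ρN Mu : ℤ → ℝ}
    (hrefC : ∀ t ∈ Icc tlo thi, P.Astar * (1 - P.γ (P.N₀ + 1)) * (1 + ε₀) ^ (-θ₀) + D ≤ |Z i₀ 1 t|)
    (hrefW : ∀ t ∈ Icc tlo thi, ∀ (i : Fin 2) (k : ℤ), -(P.K : ℤ) ≤ k → k < (P.k₁ : ℤ) →
      MirrorPulse.geomGauge P.g P.b i k * |Z i (1 + k) t - |Z i₀ 1 t| / P.Astar * ustar i k| ≤ δ₁)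
    (hMω : ∀ (i : Fin 2) (k : ℤ), -(P.K : ℤ) ≤ k → k < (P.k₁ : ℤ) → MirrorPulse.geomGauge P.g P.b i k * |ustar i k| ≤ Mω)
    (hdom : ∀ (i : Fin 2) (k : ℤ), (P.k₁ : ℤ) ≤ k →
      MirrorPulse.geomGauge P.g P.b i k * (max ((1 + ε₀) ^ (-θ₀)) ((MZ + D) / P.Astar) * r) ≤ 8 * δ₂ * w k)
    (hutail : ∀ (i : Fin 2) (k : ℤ), (P.k₁ : ℤ) ≤ k → MirrorPulse.geomGauge P.g P.b i k * |ustar i k| ≤ δ₃')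
    (hrefN : ∀ t ∈ Icc tlo thi, ∀ (i : Fin 2) (k : ℤ), -(P.D : ℤ) ≤ k → k ≤ -(P.K : ℤ) - 1 →
      |Z i (1 + k) t - |Z i₀ 1 t| / P.Astar * ustar i k| ≤ ρN k)
    (hMu : ∀ (i : Fin 2) (k : ℤ), -(P.D : ℤ) ≤ k → k ≤ -(P.K : ℤ) - 1 → |ustar i k| ≤ Mu k)
    (hrefB : ∀ t ∈ Icc tlo thi, ∀ L : ℕ,
      R54.behindEnergy P.K L θ' (fun i k => |Z i (1 + k) t| + D) ≤ ((1 + ε₀) ^ (-θ₀)) ^ 2 * Wb (P.N₀ + 1))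
    (hbudC : max (P.g ^ P.k₁ * D + δ₁ + D / P.Astar * Mω) (δ₂ + (MZ + D) / P.Astar * δ₃')
      ≤ (1 + ε₀) ^ (-θ₀) * P.δ (P.N₀ + 1))
    (hbudS : max (P.g ^ P.k₁ * D + δ₁ + D / P.Astar * Mω) (δ₂ + (MZ + D) / P.Astar * δ₃')
      ≤ (1 + ε₀) ^ (-θ₀) * δs (P.N₀ + 1))
    (hbudN : ∑ k ∈ Finset.Icc (-(P.D : ℤ)) (-(P.K : ℤ) - 1),
        Real.exp (P.θV * ((k : ℝ) + P.K)) * (Dk (1 + k) + ρN k + Dk 1 / P.Astar * Mu k) ^ 2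
      ≤ ((1 + ε₀) ^ (-θ₀)) ^ 2 * P.v (P.N₀ + 1))
    -- AHEAD: window rows and window-top hull read off the reference (+ the profile); cut schedule
    {kH : ℤ} {Vtop : ℝ} {G Ω : ℤ → ℝ} (hk₁H : (P.k₁ : ℤ) ≤ kH + 2) (hVtop : 0 ≤ Vtop) (hG0 : ∀ j, kH < j → 0 ≤ G j)
    (hrefA : ∀ t ∈ Icc tlo thi, ∀ (i : Fin 2) (k : ℤ), (P.k₁ : ℤ) ≤ k → k ≤ kH →
      8 * (w k * (|Z i (1 + k) t| + Dk (1 + k))) ≤ r * (1 - θ₀ * ε₀))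
    (hrefV : ∀ t ∈ Icc 0 c₀, |Z 1 (kH + 1) t| + Dk (kH + 1) ≤ Vtop)
    (hΩ : ∀ j, kH < j → ∀ N : Finset ℤ, (∀ m ∈ N, j < m) → ∑ m ∈ N, (w m)⁻¹ ^ 2 ≤ Ω j)
    (hGΩ : ∀ j, kH < j → 2 * (9 / 8 * r) ^ 2 * Ω j ≤ G j ^ 2)
    (hclose0 : 4 / 3 * c₀ * clock ε₀ (kH + 1) * Vtop * (Vtop + 2 * ε * G (kH + 1)) < G (kH + 1))
    (hcloseG : ∀ j, kH + 1 ≤ j →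
      4 / 3 * c₀ * clock ε₀ (j + 1) * (2 * G j) * (2 * G j + 2 * ε * G (j + 1)) < G (j + 1))
    (hGr : ∀ k, kH < k → 8 * (w k * (2 * G k)) ≤ r * (1 - θ₀ * ε₀)) :
    TubeStepLandWith P (splitBcl P (behindR54 P θ' Wb) δs i₀ ustar) (choiceRule P i₀ ε₀ θ₀ t₀ good) shiftSetFlat ε₀ i₀
      (mirrorTable ε ε) X₀ w r c₀ ζ ustar P.N₀ := by
  have hε' : (-1 : ℝ) < ε₀ := by linarith
  have hw0 : ∀ k, 0 < w k := fun k => lt_of_lt_of_le one_pos (hw1 k)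
  have hdev : ∀ z S₀ τ S F, HopPremiseWith P (splitBcl P (behindR54 P θ' Wb) δs i₀ ustar) shiftSetFlat ε₀ i₀ (mirrorTable ε ε) X₀ w
      r c₀ ζ ustar P.N₀ z S₀ τ S F → ∀ (i : Fin 2) (k : ℤ), ∀ s ∈ Icc 0 c₀, |S i k s - Z i k s| ≤ D :=
    fun z S₀ τ S F h i k s hs => (hdevk z S₀ τ S F h i k s hs).trans (hDk k)
  -- AHEAD of the landed state along every premise at every good time (cut schedule)
  have hwinA : AheadWindowWith P (splitBcl P (behindR54 P θ' Wb) δs i₀ ustar) shiftSetFlat ε₀ i₀ (mirrorTable ε ε) X₀ w r c₀ ζ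
      ustar good P.N₀ kH (1 - θ₀ * ε₀) := by
    intro z S₀ τ S F hprem t ht i k hk hkH
    obtain ⟨h1, h2⟩ := hwin z S₀ τ S F hprem t ht
    have hd := hdevk z S₀ τ S F hprem i (1 + k) t ⟨htlo.le.trans h1, h2.trans hthi⟩
    have hS : |S i (1 + k) t| ≤ |Z i (1 + k) t| + Dk (1 + k) := by
      have := abs_sub_abs_le_abs_sub (S i (1 + k) t) (Z i (1 + k) t); linarith
    exact (mul_le_mul_of_nonneg_left (mul_le_mul_of_nonneg_left hS (hw0 k).le) (by norm_num)).trans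
      (hrefA t ⟨h1, h2⟩ i k hk hkH)
  have hVt : ∀ z S₀ τ S F, HopPremiseWith P (splitBcl P (behindR54 P θ' Wb) δs i₀ ustar) shiftSetFlat ε₀ i₀ (mirrorTable ε ε) X₀
      w r c₀ ζ ustar P.N₀ z S₀ τ S F → ∀ t ∈ Icc 0 c₀, |S 1 (kH + 1) t| ≤ Vtop := by
    intro z S₀ τ S F hprem t ht
    have hd := hdevk z S₀ τ S F hprem 1 (kH + 1) t ht
    have := abs_sub_abs_le_abs_sub (S 1 (kH + 1) t) (Z 1 (kH + 1) t)
    linarith [hrefV t ht]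
  have hinit : ∀ j, kH < j → ∀ z S₀ τ S F,
      HopPremiseWith P (splitBcl P (behindR54 P θ' Wb) δs i₀ ustar) shiftSetFlat ε₀ i₀ (mirrorTable ε ε) X₀ w r c₀ ζ ustar P.N₀
        z S₀ τ S F → ∀ N : Finset ℤ, (∀ m ∈ N, j < m) → ∑ m ∈ N, ∑ i : Fin 2, S₀ i m ^ 2 ≤ G j ^ 2 := by
    intro j hj z S₀ τ S F hprem N hN
    obtain ⟨hz, hkick, -, -⟩ := hprem
    obtain ⟨-, hA⟩ := capture_of_inTubeWith_le P le_rfl hζ0 hη0 hk₁ hr0 hz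
    exact (initialTail_le_of_clauses P hw0 hr0 hA hkick (by omega) hN (hΩ j hj N hN)).trans (hGΩ j hj)
  have hgoodI : ∀ z S₀ τ S F, HopPremiseWith P (splitBcl P (behindR54 P θ' Wb) δs i₀ ustar) shiftSetFlat ε₀ i₀ (mirrorTable ε ε)
      X₀ w r c₀ ζ ustar P.N₀ z S₀ τ S F → ∀ t, good P.N₀ S t → t ∈ Icc 0 c₀ := fun z S₀ τ S F h t ht =>
    ⟨htlo.le.trans (hwin z S₀ τ S F h t ht).1, (hwin z S₀ τ S F h t ht).2.trans hthi⟩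
  have hratio : ∀ z S₀ τ S F, HopPremiseWith P (splitBcl P (behindR54 P θ' Wb) δs i₀ ustar) shiftSetFlat ε₀ i₀ (mirrorTable ε ε)
      X₀ w r c₀ ζ ustar P.N₀ z S₀ τ S F → ∀ t, good P.N₀ S t → 1 - θ₀ * ε₀ ≤ clampedRatio P i₀ ε₀ θ₀ t S :=
    fun z S₀ τ S _ _ t _ => one_sub_mul_le_clampedRatio P i₀ hε₀.le hθ₀ hθ₀1 t S
  have hahead := aheadClause_of_schedule (a := fun S t => clampedRatio P i₀ ε₀ θ₀ t S) hε hε₀ hc₀.le hr0 (fun k => (hw0 k).le)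
    hAFL hVtop hG0 hwinA hVt hinit hclose0 hcloseG hGr hgoodI hratio
  -- the landing at the chosen good time
  intro z S₀ τ S F hprem
  have hgood := chooseTime_spec (t₀ := t₀) (hex z S₀ τ S F hprem)
  set t := chooseTime good t₀ P.N₀ S with ht_def
  obtain ⟨htlo_le, hthi'⟩ := hwin z S₀ τ S F hprem t hgood
  have htc₀ : t ≤ c₀ := hthi'.trans hthi
  have ht0 : t ∈ Icc 0 c₀ := ⟨htlo.le.trans htlo_le, htc₀⟩
  have htI : t ∈ Icc tlo thi := ⟨htlo_le, hthi'⟩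
  have hd : ∀ (i : Fin 2) (k : ℤ), |S i k t - Z i k t| ≤ D := fun i k => hdev z S₀ τ S F hprem i k t ht0
  have hcap : ∃ Λ : ℝ, 0 ≤ Λ ∧ R54.BehindCapClause P.K Λ (recentre S t (clampedRatio P i₀ ε₀ θ₀ t S)) := by
    obtain ⟨-, -, hc₀τ, hflow⟩ := hprem
    exact R54.exists_behindCap_recentre hflow hε'.le ⟨ht0.1, htc₀.trans hc₀τ⟩ (clampedRatio_pos P i₀ hε' θ₀ t S) P.K
  have hdkt : ∀ (i : Fin 2) (k : ℤ), |S i k t - Z i k t| ≤ Dk k := fun i k => hdevk z S₀ τ S F hprem i k t ht0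
  have hL := entryLanding_of_devW (δs := δs) (θ' := θ') (Wb := Wb) P hε₀ hAstar hg hb hθV hw0 hr0 hγ hδ hδs hv hWb hdkt hDk
    (fun i k => hZp i k t ht0) hcap (hahead z S₀ τ S F hprem t hgood) (hrefC t htI) (hrefW t htI) hMω hdom hutail (hrefN t htI)
    hMu (hrefB t htI) hbudC hbudS hbudN
  simp only [choiceRule_τ₁, choiceRule_a]
  exact hL


end EntryW

end Summit.NavierStokesRegularity.NavierStokesRegularity.Theorems.HopTube

end
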